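import Summits.Ventures.PercRepro.PuncturedLYMSingleMain

/-!
# PercRepro — (SP) FOR ONE CODE WORD, PART 3: THE FLUX SEQUENCE AND THE THEOREM (p10, gen 30; continues
PuncturedLYMSingleMain)

THE FLUX SEQUENCE (paper §3b, Kirchhoff on the radial quotient): with the class sizes `classCount n j i = C(j,i)·C(n−j, j+1−i)`
(the `(j+1)`-sets meeting `B` in `i` points), their partial sums `cumCount n j m = Σ_{i ≤ m} classCount n j i` and the cut sizes
`cutEdges n j m = classCount n j m · (j+1−m) · (j−m)` (the edges between the classes `m` and `m+1`),

    `dFlux m = τ · cumCount m / cutEdges m`,   `τ = (n − j)/C(n, j+1)`.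

* `cumCount_le_choose` — `C_{≤m} ≤ C(n, j+1)` (Vandermonde);
* `cutEdges_pred` — `m(n−2j−1+m)·classCount m = cutEdges (m−1)` (two `choose_succ_right_eq` identities);
* `dFlux_rec`, `dFlux_top` — the Kirchhoff recurrence on the non-empty classes and its top equation;
* `dFlux_nonneg`, `dFlux_bound` — `0 ≤ dFlux a` and `(j−a)·dFlux a ≤ 1` (the cut through the class `a` has at least
  `n − j` edges per unit of source: `C(n−j, t)·t = (n−j)·C(n−j−1, t−1) ≥ n − j`);
* **`puncturedNMP_singleton` — (SP) HOLDS FOR EVERY CODE WITH ONE WORD** (every `n`, every `j`), by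
  `puncturedNMP_single_of_seq`.
Nothing here asserts (SP) for `#D ≥ 2`.
-/

namespace PercRepro.PuncturedLYM

open Finset

/-! ### The class sizes and the flux sequence -/

/-- The number of `(j+1)`-subsets of `[n]` meeting a fixed `j`-set in exactly `i` points. -/
def classCount (n j i : ℕ) : ℕ := j.choose i * (n - j).choose (j + 1 - i)

/-- `C_{≤m} = Σ_{i ≤ m} classCount n j i`. -/
def cumCount (n j m : ℕ) : ℕ := ∑ i ∈ range (m + 1), classCount n j i

/-- The number of edges of the punctured Johnson graph between the classes `m` and `m + 1`. -/
def cutEdges (n j m : ℕ) : ℕ := classCount n j m * (j + 1 - m) * (j - m)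

/-- Vandermonde: `Σ_{i ≤ j+1} classCount n j i = C(n, j+1)` for `j ≤ n`. -/
theorem sum_classCount {n j : ℕ} (hj : j ≤ n) : cumCount n j (j + 1) = n.choose (j + 1) := by
  unfold cumCount classCount
  have h := Nat.add_choose_eq j (n - j) (j + 1)
  rw [Nat.add_sub_cancel' hj] at h
  rw [h, Nat.sum_antidiagonal_eq_sum_range_succ (fun a b => j.choose a * (n - j).choose b)]

/-- `C_{≤m} ≤ C(n, j+1)` for `m ≤ j + 1`, `j ≤ n`. -/
theorem cumCount_le_choose {n j m : ℕ} (hj : j ≤ n) (hm : m ≤ j + 1) : cumCount n j m ≤ n.choose (j + 1) := by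
  rw [← sum_classCount hj]
  unfold cumCount
  apply sum_le_sum_of_subset
  intro i hi
  rw [mem_range] at hi ⊢
  omega

/-- `cumCount (m+1) = cumCount m + classCount (m+1)`. -/
theorem cumCount_succ (n j m : ℕ) : cumCount n j (m + 1) = cumCount n j m + classCount n j (m + 1) := by
  unfold cumCount
  rw [sum_range_succ]

/-- The cut identity: `m·(n+m−2j−1)·classCount m = cutEdges (m−1)` for `1 ≤ m ≤ j` and `2j + 2 ≤ n + m`. -/
theorem cutEdges_pred {n j m : ℕ} (hm1 : 1 ≤ m) (hmj : m ≤ j) (hn : 2 * j + 2 ≤ n + m) :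
    m * (n + m - 2 * j - 1) * classCount n j m = cutEdges n j (m - 1) := by
  obtain ⟨m', rfl⟩ : ∃ m', m = m' + 1 := ⟨m - 1, by omega⟩
  simp only [Nat.add_sub_cancel]
  unfold cutEdges classCount
  have h1 := Nat.choose_succ_right_eq j m'
  have h2 := Nat.choose_succ_right_eq (n - j) (j - m')
  have e1 : j + 1 - (m' + 1) = j - m' := by omega
  have e2 : j + 1 - m' = j - m' + 1 := by omega
  have e3 : n - j - (j - m') = n + (m' + 1) - 2 * j - 1 := by omega
  rw [e3] at h2
  rw [e1, e2]
  calc (m' + 1) * (n + (m' + 1) - 2 * j - 1) * (j.choose (m' + 1) * (n - j).choose (j - m'))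
      = (j.choose (m' + 1) * (m' + 1)) * ((n - j).choose (j - m') * (n + (m' + 1) - 2 * j - 1)) := by ring
    _ = (j.choose m' * (j - m')) * ((n - j).choose (j - m' + 1) * (j - m' + 1)) := by rw [h1, h2]
    _ = j.choose m' * (n - j).choose (j - m' + 1) * (j - m' + 1) * (j - m') := by ring

/-- The flux sequence `dFlux m = τ · C_{≤m} / cutEdges m`. -/
def dFlux (α : Type) [Fintype α] (j m : ℕ) : ℚ :=
  tauQ α j * (cumCount (Fintype.card α) j m : ℚ) / (cutEdges (Fintype.card α) j m : ℚ)

variable {α : Type} [Fintype α] [DecidableEq α]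

omit [DecidableEq α] in
/-- `τ ≥ 0` for `j ≤ n`. -/
theorem tauQ_nonneg {j : ℕ} (hj : j ≤ Fintype.card α) : 0 ≤ tauQ α j := by
  unfold tauQ
  apply div_nonneg
  · have : (j : ℚ) ≤ Fintype.card α := by exact_mod_cast hj
    linarith
  · positivity

omit [DecidableEq α] in
/-- `τ · C(n, j+1) = n − j` for `j < n`. -/
theorem tauQ_mul_choose {j : ℕ} (hj : j < Fintype.card α) :
    tauQ α j * ((Fintype.card α).choose (j + 1) : ℕ) = (Fintype.card α : ℚ) - j := by
  unfold tauQ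
  have : (((Fintype.card α).choose (j + 1) : ℕ) : ℚ) ≠ 0 := by
    exact_mod_cast (Nat.choose_pos hj).ne'
  field_simp

omit [DecidableEq α] in
/-- `0 ≤ dFlux a` on the classes with `j ≤ n`. -/
theorem dFlux_nonneg {j a : ℕ} (hj : j ≤ Fintype.card α) : 0 ≤ dFlux α j a := by
  unfold dFlux
  apply div_nonneg
  · exact mul_nonneg (tauQ_nonneg hj) (by positivity)
  · positivity

omit [DecidableEq α] in
/-- `C(N, t) · t ≥ N` for `1 ≤ t ≤ N`. -/
theorem choose_mul_ge {N t : ℕ} (ht1 : 1 ≤ t) (htN : t ≤ N) : N ≤ N.choose t * t := by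
  obtain ⟨N', rfl⟩ : ∃ N', N = N' + 1 := ⟨N - 1, by omega⟩
  obtain ⟨t', rfl⟩ : ∃ t', t = t' + 1 := ⟨t - 1, by omega⟩
  have h := Nat.add_one_mul_choose_eq N' t'
  rw [← h]
  have : 0 < N'.choose t' := Nat.choose_pos (by omega)
  nlinarith

omit [DecidableEq α] in
/-- **The gradient bound** `(j − a) · dFlux a ≤ 1` on the non-empty classes (`a < j`, `2j + 1 ≤ n + a`). -/
theorem dFlux_bound {j a : ℕ} (ha : a < j) (hcls : 2 * j + 1 ≤ Fintype.card α + a) :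
    ((j : ℚ) - a) * dFlux α j a ≤ 1 := by
  have hjn : j < Fintype.card α := by omega
  unfold dFlux
  have hcut : cutEdges (Fintype.card α) j a = classCount (Fintype.card α) j a * (j + 1 - a) * (j - a) := rfl
  have hcc : 0 < classCount (Fintype.card α) j a := by
    unfold classCount
    exact Nat.mul_pos (Nat.choose_pos ha.le) (Nat.choose_pos (by omega))
  have hcutpos : 0 < cutEdges (Fintype.card α) j a := by
    rw [hcut]
    exact Nat.mul_pos (Nat.mul_pos hcc (by omega)) (by omega)
  have hcutq : (0 : ℚ) < (cutEdges (Fintype.card α) j a : ℕ) := by exact_mod_cast hcutpos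
  rw [mul_div_assoc', div_le_one hcutq]
  -- `(j − a) · τ · C_{≤a} ≤ cutEdges a = classCount a · (j+1−a) · (j−a)`
  have hja : ((j : ℚ) - a) = ((j - a : ℕ) : ℚ) := by rw [Nat.cast_sub ha.le]
  rw [hja, hcut]
  push_cast
  have h1 : tauQ α j * (cumCount (Fintype.card α) j a : ℚ) ≤ (Fintype.card α : ℚ) - j := by
    calc tauQ α j * (cumCount (Fintype.card α) j a : ℚ) ≤ tauQ α j * (((Fintype.card α).choose (j + 1) : ℕ) : ℚ) := by
          apply mul_le_mul_of_nonneg_left _ (tauQ_nonneg hjn.le)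
          exact_mod_cast cumCount_le_choose hjn.le (by omega)
      _ = (Fintype.card α : ℚ) - j := tauQ_mul_choose hjn
  have h2 : (Fintype.card α : ℚ) - j ≤ (classCount (Fintype.card α) j a : ℚ) * ((j + 1 - a : ℕ) : ℚ) := by
    have h3 : Fintype.card α - j ≤ classCount (Fintype.card α) j a * (j + 1 - a) := by
      unfold classCount
      calc Fintype.card α - j ≤ (Fintype.card α - j).choose (j + 1 - a) * (j + 1 - a) := choose_mul_ge (by omega) (by omega)
        _ = 1 * ((Fintype.card α - j).choose (j + 1 - a) * (j + 1 - a)) := (one_mul _).symm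
        _ ≤ j.choose a * ((Fintype.card α - j).choose (j + 1 - a) * (j + 1 - a)) :=
            Nat.mul_le_mul_right _ (Nat.choose_pos ha.le)
        _ = j.choose a * (Fintype.card α - j).choose (j + 1 - a) * (j + 1 - a) := by ring
    have h4 : ((Fintype.card α - j : ℕ) : ℚ) ≤ ((classCount (Fintype.card α) j a * (j + 1 - a) : ℕ) : ℚ) := by exact_mod_cast h3
    rw [Nat.cast_sub hjn.le] at h4
    push_cast at h4
    exact h4
  have hja' : (0 : ℚ) ≤ ((j - a : ℕ) : ℚ) := by positivity
  calc ((j - a : ℕ) : ℚ) * (tauQ α j * (cumCount (Fintype.card α) j a : ℚ)) ≤ ((j - a : ℕ) : ℚ) * ((Fintype.card α : ℚ) - j) :=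
        mul_le_mul_of_nonneg_left h1 hja'
    _ ≤ ((j - a : ℕ) : ℚ) * ((classCount (Fintype.card α) j a : ℚ) * ((j + 1 - a : ℕ) : ℚ)) := mul_le_mul_of_nonneg_left h2 hja'
    _ = (classCount (Fintype.card α) j a : ℚ) * ((j + 1 - a : ℕ) : ℚ) * ((j - a : ℕ) : ℚ) := by ring

omit [DecidableEq α] in
/-- **The Kirchhoff recurrence** on the non-empty classes (`m < j`, `2j + 1 ≤ n + m`). -/
theorem dFlux_rec {j m : ℕ} (hm : m < j) (hcls : 2 * j + 1 ≤ Fintype.card α + m) :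
    (m : ℚ) * ((Fintype.card α : ℚ) - 2 * j - 1 + m) * dFlux α j (m - 1)
      - ((j : ℚ) + 1 - m) * ((j : ℚ) - m) * dFlux α j m = - tauQ α j := by
  have hjn : j < Fintype.card α := by omega
  have hcc : 0 < classCount (Fintype.card α) j m := by
    unfold classCount
    exact Nat.mul_pos (Nat.choose_pos hm.le) (Nat.choose_pos (by omega))
  have hccq : (0 : ℚ) < (classCount (Fintype.card α) j m : ℕ) := by exact_mod_cast hcc
  have hcut : cutEdges (Fintype.card α) j m = classCount (Fintype.card α) j m * (j + 1 - m) * (j - m) := rfl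
  have hcutq : ((cutEdges (Fintype.card α) j m : ℕ) : ℚ) = (classCount (Fintype.card α) j m : ℚ) * ((j : ℚ) + 1 - m) * ((j : ℚ) - m) := by
    rw [hcut]
    push_cast [Nat.cast_sub hm.le, Nat.cast_sub (by omega : m ≤ j + 1)]
    ring
  -- the second term is `τ · C_{≤m} / classCount m`
  have hterm2 : ((j : ℚ) + 1 - m) * ((j : ℚ) - m) * dFlux α j m = tauQ α j * (cumCount (Fintype.card α) j m : ℚ) / (classCount (Fintype.card α) j m : ℚ) := by
    unfold dFlux
    rw [hcutq]
    have h1 : ((j : ℚ) + 1 - m) ≠ 0 := by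
      have : (m : ℚ) < j + 1 := by exact_mod_cast (by omega : m < j + 1)
      linarith
    have h2 : ((j : ℚ) - m) ≠ 0 := by
      have : (m : ℚ) < j := by exact_mod_cast hm
      linarith
    field_simp
  rcases Nat.eq_zero_or_pos m with h0 | hpos
  · -- `m = 0`: the first term vanishes and `C_{≤0} = classCount 0`
    subst h0
    have hcum0 : cumCount (Fintype.card α) j 0 = classCount (Fintype.card α) j 0 := by
      unfold cumCount
      rw [sum_range_one]
    have h0 : ((j : ℚ) + 1 - (0 : ℕ)) * ((j : ℚ) - (0 : ℕ)) * dFlux α j 0 = tauQ α j := by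
      rw [hterm2, hcum0, mul_div_assoc, div_self hccq.ne', mul_one]
    simp only [Nat.cast_zero, zero_mul, zero_sub, sub_zero] at h0 ⊢
    rw [h0]
  · rcases Nat.lt_or_ge (Fintype.card α + m) (2 * j + 2) with hlow | hhigh
    · -- the boundary class: `2j + 1 = Fintype.card α + m`, the lower class is empty and the first term vanishes
      have he : (Fintype.card α : ℚ) - 2 * j - 1 + m = 0 := by
        have : Fintype.card α + m = 2 * j + 1 := by omega
        have h' : (Fintype.card α : ℚ) + m = 2 * j + 1 := by exact_mod_cast this
        linarith
      rw [he, mul_zero, zero_mul, zero_sub, hterm2]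
      -- `C_{≤m} = classCount m` since the classes below are empty
      have hcum : cumCount (Fintype.card α) j m = classCount (Fintype.card α) j m := by
        obtain ⟨m', rfl⟩ : ∃ m', m = m' + 1 := ⟨m - 1, by omega⟩
        rw [cumCount_succ]
        have : cumCount (Fintype.card α) j m' = 0 := by
          unfold cumCount classCount
          apply sum_eq_zero
          intro i hi
          rw [mem_range] at hi
          rw [Nat.choose_eq_zero_of_lt (by omega : Fintype.card α - j < j + 1 - i), mul_zero]
        rw [this, zero_add]
      have hcc' := hccq.ne'
      rw [hcum]
      field_simp
    · -- both classes non-empty: the cut identity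
      have hcutm1 : ((cutEdges (Fintype.card α) j (m - 1) : ℕ) : ℚ) =
          (m : ℚ) * ((Fintype.card α : ℚ) - 2 * j - 1 + m) * (classCount (Fintype.card α) j m : ℚ) := by
        rw [← cutEdges_pred hpos hm.le hhigh]
        have hc : ((Fintype.card α + m - 2 * j - 1 : ℕ) : ℚ) = (Fintype.card α : ℚ) - 2 * j - 1 + m := by
          rw [Nat.cast_sub (by omega : 1 ≤ Fintype.card α + m - 2 * j),
            Nat.cast_sub (by omega : 2 * j ≤ Fintype.card α + m)]
          push_cast
          ring
        push_cast
        rw [hc]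
      have hterm1 : (m : ℚ) * ((Fintype.card α : ℚ) - 2 * j - 1 + m) * dFlux α j (m - 1) =
          tauQ α j * (cumCount (Fintype.card α) j (m - 1) : ℚ) / (classCount (Fintype.card α) j m : ℚ) := by
        unfold dFlux
        rw [hcutm1]
        have hm' : (m : ℚ) ≠ 0 := by exact_mod_cast hpos.ne'
        have he : (Fintype.card α : ℚ) - 2 * j - 1 + m ≠ 0 := by
          have : (2 * j + 2 : ℚ) ≤ Fintype.card α + m := by exact_mod_cast hhigh
          linarith
        field_simp
      rw [hterm1, hterm2]
      have hcum : cumCount (Fintype.card α) j m = cumCount (Fintype.card α) j (m - 1) + classCount (Fintype.card α) j m := by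
        obtain ⟨m', rfl⟩ : ∃ m', m = m' + 1 := ⟨m - 1, by omega⟩
        simp only [Nat.add_sub_cancel]
        exact cumCount_succ (Fintype.card α) j m'
      rw [hcum]
      push_cast
      field_simp
      ring

omit [DecidableEq α] in
/-- **The top equation** `j(n−j−1)·dFlux(j−1) = 1 − τ` (`0 < j < n`). -/
theorem dFlux_top {j : ℕ} (hj : 0 < j) (hjn : j < Fintype.card α) :
    (j : ℚ) * ((Fintype.card α : ℚ) - j - 1) * dFlux α j (j - 1) = 1 - tauQ α j := by
  have hτ := tauQ_mul_choose hjn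
  -- `cutEdges (j−1) = j · C(Fintype.card α−j, 2) · 2 = j (Fintype.card α−j)(Fintype.card α−j−1)`; `C_{≤ j−1} = C(Fintype.card α, j+1) − (Fintype.card α − j)`
  have hcut : cutEdges (Fintype.card α) j (j - 1) = j * ((Fintype.card α - j) * (Fintype.card α - j - 1)) := by
    unfold cutEdges classCount
    obtain ⟨j', rfl⟩ : ∃ j', j = j' + 1 := ⟨j - 1, by omega⟩
    simp only [Nat.add_sub_cancel]
    have e1 : j' + 1 + 1 - j' = 2 := by omega
    have e2 : j' + 1 - j' = 1 := by omega
    rw [e1, e2, Nat.choose_two_right]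
    have h := Nat.choose_succ_right_eq (j' + 1) j'
    rw [Nat.choose_succ_self_right] at h
    have hsym : (j' + 1).choose j' = j' + 1 := Nat.choose_succ_self_right j'
    rw [hsym]
    have hdiv : (Fintype.card α - (j' + 1)) * (Fintype.card α - (j' + 1) - 1) / 2 * 2 = (Fintype.card α - (j' + 1)) * (Fintype.card α - (j' + 1) - 1) := by
      apply Nat.div_mul_cancel
      exact Nat.even_mul_pred_self _ |>.two_dvd
    calc (j' + 1) * ((Fintype.card α - (j' + 1)) * (Fintype.card α - (j' + 1) - 1) / 2) * 2 * 1
        = (j' + 1) * ((Fintype.card α - (j' + 1)) * (Fintype.card α - (j' + 1) - 1) / 2 * 2) := by ring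
      _ = (j' + 1) * ((Fintype.card α - (j' + 1)) * (Fintype.card α - (j' + 1) - 1)) := by rw [hdiv]
  have hcum : cumCount (Fintype.card α) j (j - 1) + (Fintype.card α - j) = (Fintype.card α).choose (j + 1) := by
    rw [← sum_classCount hjn.le]
    have e : j + 1 = (j - 1) + 1 + 1 := by omega
    rw [e, cumCount_succ, cumCount_succ]
    have h1 : classCount (Fintype.card α) j (j - 1 + 1) = Fintype.card α - j := by
      unfold classCount
      have e1 : j - 1 + 1 = j := by omega
      rw [e1, Nat.choose_self, Nat.add_sub_cancel_left, Nat.choose_one_right, one_mul]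
    have h2 : classCount (Fintype.card α) j (j - 1 + 1 + 1) = 0 := by
      unfold classCount
      have e1 : j - 1 + 1 + 1 = j + 1 := by omega
      rw [e1, Nat.choose_succ_self, zero_mul]
    rw [h1, h2]
    omega
  unfold dFlux
  rw [hcut]
  rcases Nat.lt_or_ge (j + 1) (Fintype.card α) with hn2 | hn2
  · have hpos : (0 : ℚ) < (Fintype.card α : ℚ) - j - 1 := by
      have : (j + 1 : ℚ) < Fintype.card α := by exact_mod_cast hn2
      linarith
    have hjq : (0 : ℚ) < j := by exact_mod_cast hj
    have hnj : (0 : ℚ) < (Fintype.card α : ℚ) - j := by linarith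
    have hcumq : (cumCount (Fintype.card α) j (j - 1) : ℚ) = (((Fintype.card α).choose (j + 1) : ℕ) : ℚ) - ((Fintype.card α : ℚ) - j) := by
      have : ((cumCount (Fintype.card α) j (j - 1) + (Fintype.card α - j) : ℕ) : ℚ) = (((Fintype.card α).choose (j + 1) : ℕ) : ℚ) := by rw [hcum]
      push_cast [Nat.cast_sub hjn.le] at this
      linarith
    rw [hcumq]
    have key : tauQ α j * (((Fintype.card α).choose (j + 1) : ℕ) - ((Fintype.card α : ℚ) - j)) =
        ((Fintype.card α : ℚ) - j) * (1 - tauQ α j) := by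
      linear_combination hτ
    have hc1 : ((Fintype.card α - j : ℕ) : ℚ) = (Fintype.card α : ℚ) - j := by rw [Nat.cast_sub hjn.le]
    have hc2 : ((Fintype.card α - j - 1 : ℕ) : ℚ) = (Fintype.card α : ℚ) - j - 1 := by
      rw [Nat.cast_sub (by omega : 1 ≤ Fintype.card α - j), hc1]
      push_cast
      ring
    push_cast
    rw [hc1, hc2, mul_div_assoc', key]
    field_simp
  · -- `Fintype.card α = j + 1`: both sides vanish (`τ = 1`)
    have hn1 : Fintype.card α = j + 1 := by omega
    have hcut0 : (j : ℚ) * ((Fintype.card α - j) * (Fintype.card α - j - 1) : ℕ) = 0 := by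
      rw [hn1]
      simp
    have hτ1 : tauQ α j = 1 := by
      unfold tauQ
      rw [hn1, Nat.choose_self]
      push_cast
      ring
    rw [hτ1]
    push_cast
    have : ((Fintype.card α : ℚ) - j - 1) = 0 := by
      rw [hn1]
      push_cast
      ring
    rw [this]
    ring

/-- **(SP) HOLDS FOR EVERY CODE WITH ONE WORD.** -/
theorem puncturedNMP_singleton {j : ℕ} {B : Finset α} (hB : B.card = j) :
    PuncturedNMP j ({B} : Finset (Finset α)) :=
  puncturedNMP_single_of_seq hB (dFlux α j)
    (fun m hm hcls => dFlux_rec hm hcls)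
    (fun hj hjn => dFlux_top hj hjn)
    (fun _ ha hcls => dFlux_nonneg (by omega))
    (fun _ ha hcls => dFlux_bound ha hcls)

end PercRepro.PuncturedLYM
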